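import Mathlib
import Summits.AtomisticToContinuum.FouriersLaw.Theses.OddSectorIrreversibility
import Summits.AtomisticToContinuum.FouriersLaw.Theses.BoundaryEscapeDeficit
import Summits.AtomisticToContinuum.FouriersLaw.Theses.JunctionLocality
import Summits.AtomisticToContinuum.FouriersLaw.Theorems.BoundedResponseConverges.Negative.OscillationExcluded
import Summits.AtomisticToContinuum.FouriersLaw.Theorems.JunctionLocalitySuperadditiveResistanceStubLinearResponsePlain
import Literature.MathematicalPhysics.KineticTheory.LangevinChainNESSHolds

/-!
# Crux `BoundedResponseConverges` (stmt-AtomisticToContinuum-9141), line `escape-deficit-dichotomy` —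
# supply map for `stub_escapeNonOscillation`: superadditive resistance ALONE excludes oscillation

Support file (lead c5) for the registered stub `stub_escapeNonOscillation`
(= `BoundaryEscapeDeficit.EscapeNonOscillation`, item stmt-AtomisticToContinuum-12238, by name) of the line
`escape-deficit-dichotomy` (`Cruxes/BoundedResponseConverges/Lines/escape_deficit_dichotomy.lean`).

The landed Negative lane (`Negative/OscillationExcluded`: `boundedResponseConverges_seq_tendsto_zero_or_pos`,
`boundedResponseConverges_iff_noBoundedInsulator`) shows that the junction-locality bet (A)
`JunctionLocality.SuperadditiveResistance` (stmt-11748) excludes oscillation of a BOUNDED response sequence.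
Here the boundedness is dropped by working in `EReal`, which is exactly the shape of the stub:

* `ereal_tendsto_of_superadditive_resistance` — sequence level: if `D n > 0` (`n ≥ 2`) and the resistances
  `R n = (n-1)/D n` are superadditive up to an additive constant on `{n, m ≥ 2}`, then `↑(D n)` converges in
  `EReal` — a TRICHOTOMY `0` / `k ∈ (0,∞)` / `⊤` (Fekete on `{n ≥ 2}` for `R n - C`: slopes tend to
  `s = sup ∈ [0, ∞]`; `s = ∞` is the insulator `D → 0`, `s ∈ (0,∞)` the conductor `D → 1/s`, `s = 0` forces
  `R n ≤ C`, i.e. the ballistic `D n ≥ (n-1)/C → ∞`). No boundedness, no floor.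
* `responseRegular_of_superadditiveResistance` — by name: (A) ⇒ `EReal`-regularity of EVERY response sequence of
  the crux's frame (the "regular" half of the landed exact split
  `positiveOrInfiniteLimit_iff_conductanceLowerBound_and_regular`), the positivity input being the PROVED
  `JunctionLocality.PositiveConductance` (`positiveConductance_proof`, stmt-11750).
* `escapeNonOscillation_of_superadditiveResistance : SuperadditiveResistance → EscapeNonOscillation` — by name:
  stmt-11748 ALONE closes stub 1 of the line (equivalently item 12238), unconditionally otherwise (weak-NESS
  uniqueness `NessUnique_holds`, the response identity `responseIdentity_proof` and NESS existence
  `pinnedChain_exists_isSteadyState` are all proved in tree). Together with the landed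
  `boundedResponseConverges_of_junctionLocality` (11748 ∧ 11749 ⇒ crux, p103088) this says: on the line
  `escape-deficit-dichotomy`, granted (A), only `stub_conductanceFloor` (11749) remains — the sequence-level
  content of `boundedResponseConverges_iff_noBoundedInsulator`, now stated stub by stub and without `BddAbove`.

Nothing here closes an item: (A) is open (crux of route `JunctionLocality`, size XL).
-/

noncomputable section

open Filter Topology Set

namespace Summit.AtomisticToContinuum.FouriersLaw.Theorems.EscapeDeficitDichotomy

open Summit.AtomisticToContinuum.FouriersLaw.Theses
open Summit.AtomisticToContinuum.FouriersLaw.Theorems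
open Literature.MathematicalPhysics.KineticTheory.HeatConduction

/-! ## Sequence level: superadditive resistance ⇒ `EReal`-limit of the conductance (trichotomy) -/

/-- **Superadditive resistance excludes oscillation, unboundedly.** If `D n > 0` for `n ≥ 2` and
`(n-1)/D n + (m-1)/D m - C ≤ (n+m-1)/D (n+m)` for `n, m ≥ 2`, then `↑(D n)` has a limit in `EReal`
(namely `0`, or `1/s` for the Fekete slope `s ∈ (0,∞)` of `n ↦ (n-1)/D n - C`, or `⊤`). [folklore] -/
theorem ereal_tendsto_of_superadditive_resistance {D : ℕ → ℝ} {C : ℝ}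
    (hpos : ∀ N : ℕ, 2 ≤ N → 0 < D N)
    (hsup : ∀ N M : ℕ, 2 ≤ N → 2 ≤ M →
      ((N : ℝ) - 1) / D N + ((M : ℝ) - 1) / D M - C ≤ ((N : ℝ) + (M : ℝ) - 1) / D (N + M)) :
    ∃ ℓ : EReal, Tendsto (fun N : ℕ => ((D N : ℝ) : EReal)) atTop (𝓝 ℓ) := by
  rcases conductanceLowerBound_seq_insulator_or_lowerBound hpos hsup with h0 | ⟨c, hc, N₁, hN₁⟩
  · -- insulator: `D → 0`
    exact ⟨((0 : ℝ) : EReal), (continuous_coe_real_ereal.tendsto _).comp h0⟩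
  -- eventual floor `D n ≥ c > 0`: the superadditive sequence `a n = R n - C` has bounded slopes
  set a : ℕ → ℝ := fun N => ((N : ℝ) - 1) / D N - C with ha
  have hsa : ∀ n m : ℕ, 2 ≤ n → 2 ≤ m → a n + a m ≤ a (n + m) := by
    intro n m hn hm
    have := hsup n m hn hm
    simp only [ha]
    push_cast
    linarith
  set M : ℝ := (∑ n ∈ Finset.range N₁, |a n / n|) + (1 / c + |C|) with hM
  have hslope : ∀ n : ℕ, 2 ≤ n → a n / n ≤ M := by
    intro n hn
    have hn0 : (0 : ℝ) < n := by exact_mod_cast (by omega : 0 < n)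
    by_cases hlt : n < N₁
    · have h1 : a n / n ≤ |a n / n| := le_abs_self _
      have h2 : |a n / n| ≤ ∑ k ∈ Finset.range N₁, |a k / k| :=
        Finset.single_le_sum (f := fun k => |a k / k|) (fun i _ => abs_nonneg _)
          (Finset.mem_range.2 hlt)
      have h3 : (0 : ℝ) ≤ 1 / c + |C| := by positivity
      linarith
    · push Not at hlt
      have hDn : c ≤ D n := hN₁ n hlt
      have hDpos : 0 < D n := hpos n hn
      have hR : ((n : ℝ) - 1) / D n ≤ ((n : ℝ) - 1) / c :=
        div_le_div_of_nonneg_left (by linarith [show (2 : ℝ) ≤ n by exact_mod_cast hn]) hc hDn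
      have h1 : a n / n ≤ (((n : ℝ) - 1) / c + |C|) / n := by
        apply div_le_div_of_nonneg_right _ hn0.le
        simp only [ha]
        linarith [neg_le_abs C, le_abs_self C]
      have h2 : (((n : ℝ) - 1) / c + |C|) / n ≤ 1 / c + |C| := by
        rw [div_le_iff₀ hn0]
        have : ((n : ℝ) - 1) / c ≤ n / c := div_le_div_of_nonneg_right (by linarith) hc.le
        have h1n : (1 : ℝ) ≤ n := by exact_mod_cast (by omega : 1 ≤ n)
        have : n / c = 1 / c * n := by ring
        nlinarith [abs_nonneg C]
      have h0 : (0 : ℝ) ≤ ∑ k ∈ Finset.range N₁, |a k / k| :=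
        Finset.sum_nonneg fun i _ => abs_nonneg _
      linarith
  obtain ⟨s, hs, hsle⟩ := boundedResponseConverges_tendsto_div_of_superadditive hsa hslope
  by_cases hs0 : 0 < s
  · -- conductor: `D n = ((n-1)/n) / (a n / n + C / n) → 1 / s`
    refine ⟨(((1 : ℝ) / s : ℝ) : EReal), (continuous_coe_real_ereal.tendsto _).comp ?_⟩
    have hnum : Tendsto (fun n : ℕ => ((n : ℝ) - 1) / n) atTop (𝓝 1) := by
      have e : (fun n : ℕ => ((n : ℝ) - 1) / n) =ᶠ[atTop] fun n : ℕ => 1 - (n : ℝ)⁻¹ := by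
        filter_upwards [eventually_ge_atTop 1] with n hn
        have hn0 : (n : ℝ) ≠ 0 := by exact_mod_cast (by omega : n ≠ 0)
        field_simp
      rw [tendsto_congr' e]
      simpa using (tendsto_inv_atTop_nhds_zero_nat (𝕜 := ℝ)).const_sub 1
    have hden : Tendsto (fun n : ℕ => a n / n + C / n) atTop (𝓝 s) := by
      simpa using hs.add (tendsto_const_div_atTop_nhds_zero_nat C)
    have hq : Tendsto (fun n : ℕ => ((n : ℝ) - 1) / n / (a n / n + C / n)) atTop (𝓝 (1 / s)) :=
      hnum.div hden hs0.ne'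
    refine hq.congr' ?_
    filter_upwards [eventually_ge_atTop 2] with n hn
    have hn0 : (n : ℝ) ≠ 0 := by exact_mod_cast (by omega : n ≠ 0)
    have hn1 : (n : ℝ) - 1 ≠ 0 := by
      have : (2 : ℝ) ≤ n := by exact_mod_cast hn
      linarith
    have hD0 : D n ≠ 0 := (hpos n hn).ne'
    simp only [ha]
    field_simp
    have e : (n : ℝ) - 1 - D n * C + D n * C = n - 1 := by ring
    rw [e, div_self hn1]
  · -- `s ≤ 0`: then `a n ≤ 0`, i.e. `R n ≤ C`, for all `n ≥ 2` — ballistic, `D n ≥ (n-1)/C → ∞`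
    push Not at hs0
    have hRle : ∀ n : ℕ, 2 ≤ n → ((n : ℝ) - 1) / D n ≤ C := by
      intro n hn
      have hn0 : (0 : ℝ) < n := by exact_mod_cast (by omega : 0 < n)
      have h1 : a n / n ≤ 0 := (hsle n hn).trans hs0
      rw [div_le_iff₀ hn0, zero_mul] at h1
      simp only [ha] at h1
      linarith
    have hC : 0 < C := by
      have h2 := hRle 2 le_rfl
      have hD2 : 0 < D 2 := hpos 2 le_rfl
      have h21 : (0 : ℝ) < ((2 : ℕ) : ℝ) - 1 := by norm_num
      have hR2 : 0 < (((2 : ℕ) : ℝ) - 1) / D 2 := div_pos h21 hD2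
      linarith
    refine ⟨⊤, EReal.tendsto_coe_nhds_top_iff.2 ?_⟩
    -- `D n ≥ (n-1)/C`
    have hlow : ∀ n : ℕ, 2 ≤ n → ((n : ℝ) - 1) / C ≤ D n := by
      intro n hn
      have hDpos : 0 < D n := hpos n hn
      have h := hRle n hn
      rw [div_le_iff₀ hDpos] at h
      rw [div_le_iff₀ hC]
      nlinarith [mul_comm (D n) C]
    have hcmp : Tendsto (fun n : ℕ => ((n : ℝ) - 1) / C) atTop atTop :=
      Tendsto.atTop_div_const hC (tendsto_atTop_add_const_right _ _ tendsto_natCast_atTop_atTop)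
    refine tendsto_atTop_mono' atTop ?_ hcmp
    filter_upwards [eventually_ge_atTop 2] with n hn using hlow n hn

/-! ## By name: (A) `SuperadditiveResistance` ⇒ `EReal`-regularity of every response sequence -/

/-- **(A) ⇒ the "regular" half of the exact split, along every family.** Granted
`JunctionLocality.SuperadditiveResistance` (stmt-11748), under weak-NESS uniqueness, along every steady-state
family of `pinnedChain ω₂ lam β γ` (all `> 0`) and every `T > 0`, every sequence `D` of response coefficients
has a limit in `EReal` — no boundedness assumed. Positivity `D N > 0` (`N ≥ 2`) is the PROVED item 11750
(`positiveConductance_proof`). [folklore] -/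
theorem responseRegular_of_superadditiveResistance (hA : JunctionLocality.SuperadditiveResistance)
    {ω₂ lam β γ : ℝ} (hω : 0 < ω₂) (hl : 0 < lam) (hβ : 0 < β) (hγ : 0 < γ)
    (huniq : ∀ (N : ℕ) (T_L T_R : ℝ), 0 < T_L → 0 < T_R →
      ∀ μ ν : MeasureTheory.Measure (PhaseSpace N),
        (pinnedChain ω₂ lam β γ).IsSteadyState N T_L T_R μ →
        (pinnedChain ω₂ lam β γ).IsSteadyState N T_L T_R ν → μ = ν)
    (μ : (N : ℕ) → ℝ → ℝ → MeasureTheory.Measure (PhaseSpace N))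
    (hμ : ∀ (N : ℕ) (T_L T_R : ℝ), 0 < T_L → 0 < T_R →
      (pinnedChain ω₂ lam β γ).IsSteadyState N T_L T_R (μ N T_L T_R))
    {T : ℝ} (hT : 0 < T) (D : ℕ → ℝ)
    (hD : ∀ N : ℕ, Tendsto (fun δ : ℝ =>
        (pinnedChain ω₂ lam β γ).totalCurrent (μ N (T + δ / 2) (T - δ / 2)) / δ) (𝓝[≠] 0) (𝓝 (D N))) :
    ∃ ℓ : EReal, Tendsto (fun N : ℕ => ((D N : ℝ) : EReal)) atTop (𝓝 ℓ) := by
  have hpos : ∀ N : ℕ, 2 ≤ N → 0 < D N :=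
    Summit.AtomisticToContinuum.FouriersLaw.Cruxes.SuperadditiveResistance.ThermaliseThenCutProbeInsertion.positiveConductance_proof
      ω₂ lam β γ hω hl hβ hγ huniq μ hμ T hT D hD
  obtain ⟨C, hC⟩ := hA ω₂ lam β γ hω hl hβ hγ huniq μ hμ T hT D hD hpos
  exact ereal_tendsto_of_superadditive_resistance hpos hC

/-! ## By name: (A) `SuperadditiveResistance` ⇒ `stub_escapeNonOscillation` (item 12238) -/

/-- **`JunctionLocality.SuperadditiveResistance → BoundaryEscapeDeficit.EscapeNonOscillation`** (stmt-11748 ALONE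
closes the registered stub `stub_escapeNonOscillation` of line `escape-deficit-dichotomy`, i.e. item 12238).
Proof: along the canonical steady-state family (`pinnedChain_exists_isSteadyState`, junk `0` at non-positive
temperatures) the proved response identity (`responseIdentity_proof`) supplies response coefficients
`D N = (N-1)·γ·E_N` for `N ≥ 1` (`D 0 = 0`, `totalCurrent_zero`); weak-NESS uniqueness is `NessUnique_holds`;
`responseRegular_of_superadditiveResistance` gives the `EReal` limit of `↑(D N)`, eventually `↑((N-1)·γ·E_N)`.
[folklore] -/
theorem escapeNonOscillation_of_superadditiveResistance :
    Summit.AtomisticToContinuum.FouriersLaw.Theses.JunctionLocality.SuperadditiveResistance →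
      Summit.AtomisticToContinuum.FouriersLaw.Theses.BoundaryEscapeDeficit.EscapeNonOscillation := by
  intro hA ω₂ lam β γ hω hl hβ hγ T hT P K E
  classical
  have huniq := BoundaryEscapeDeficit.NessUnique_holds ω₂ lam β γ hω hl hβ hγ
  -- the canonical steady-state family
  let μ₀ : (N : ℕ) → ℝ → ℝ → MeasureTheory.Measure (PhaseSpace N) := fun N T_L T_R =>
    if h : 0 < T_L ∧ 0 < T_R then
      Classical.choose (pinnedChain_exists_isSteadyState hω hl hβ hγ N h.1 h.2) else 0
  have hμ₀ : ∀ (N : ℕ) (T_L T_R : ℝ), 0 < T_L → 0 < T_R →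
      (pinnedChain ω₂ lam β γ).IsSteadyState N T_L T_R (μ₀ N T_L T_R) := by
    intro N T_L T_R hL' hR'
    simp only [μ₀, dif_pos (And.intro hL' hR')]
    exact Classical.choose_spec (pinnedChain_exists_isSteadyState hω hl hβ hγ N hL' hR')
  have hR :=
    Summit.AtomisticToContinuum.FouriersLaw.Cruxes.SuperadditiveResistance.ThermaliseThenCutProbeInsertion.responseIdentity_proof
      ω₂ lam β γ hω hl hβ hγ huniq μ₀ hμ₀ T hT
  -- response coefficients along μ₀: the escape expression for `N ≥ 1`, `0` for the empty chain
  let D : ℕ → ℝ := fun N => if N = 0 then 0 else ((N : ℝ) - 1) * γ * E N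
  have hD : ∀ N : ℕ, Tendsto
      (fun δ : ℝ => (pinnedChain ω₂ lam β γ).totalCurrent (μ₀ N (T + δ / 2) (T - δ / 2)) / δ)
      (𝓝[≠] 0) (𝓝 (D N)) := by
    intro N
    rcases Nat.eq_zero_or_pos N with rfl | hN
    · have hD0 : D 0 = 0 := by simp [D]
      rw [hD0]
      simp only [OscillatorChain.totalCurrent_zero, zero_div]
      exact tendsto_const_nhds
    · have hDN : D N = ((N : ℝ) - 1) * γ * E N := by simp [D, hN.ne']
      rw [hDN]
      exact (hR N hN).2
  obtain ⟨ℓ, hℓ⟩ := responseRegular_of_superadditiveResistance hA hω hl hβ hγ huniq μ₀ hμ₀ hT D hD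
  refine ⟨ℓ, hℓ.congr' ?_⟩
  filter_upwards [eventually_gt_atTop 0] with N hN
  have hDN : D N = ((N : ℝ) - 1) * γ * E N := by simp [D, hN.ne']
  rw [hDN]

end Summit.AtomisticToContinuum.FouriersLaw.Theorems.EscapeDeficitDichotomy

end
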